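import Mathlib
import Summits.Parity.GeneralizedHardyLittlewood.Theorems.FordMaynardSieveConst01651SieveConst01651BuchstabCert
import HarnessLib

/-!
# Route `FordMaynardSieveConst01651`, target `SieveConst01651` (stmt-Parity-19185), stub `stub_certValuePos` (R2):
# kernel check — the rectangles of each entry are pairwise disjoint half-open boxes

Def-free helper file (step (5) of the `certP`/`certN` soundness, see `…CertAssembly`): for every table entry the
list `entryRects a b j inner` (both the inner and the outer version) is pairwise box-disjoint in the half-open sense
(`u₁ ≤ u₀' ∨ u₁' ≤ u₀ ∨ v₁ ≤ v₀' ∨ v₁' ≤ v₀`), checked by the kernel (`certRects_pairwise_disjoint`); hence the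
integrals over the rectangles `[u₀,u₁) × [v₀,v₁)` of an entry add up to the integral over their union
(`certRects_disjoint` unpacks the Boolean to `List.Pairwise`).

References: folklore.
-/

namespace Summit.Parity.GeneralizedHardyLittlewood.FordMaynardSieveConst01651SieveConst01651

/-- **Pairwise box-disjointness of every entry's rectangles** (kernel evaluation). [folklore] -/
theorem certRects_pairwise_disjoint :
    (certG2.all fun e => [true, false].all fun inner =>
      decide ((entryRects e.1 e.2.1 e.2.2.1 inner).Pairwise fun r s =>
        r.2.1 ≤ s.1 ∨ s.2.1 ≤ r.1 ∨ r.2.2.2 ≤ s.2.2.1 ∨ s.2.2.2 ≤ r.2.2.1)) = true := by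
  decide +kernel

/-- The rectangles of an entry are pairwise box-disjoint. [folklore] -/
theorem certRects_disjoint {e : ℕ × ℕ × ℕ × ℤ} (he : e ∈ certG2) (inner : Bool) :
    (entryRects e.1 e.2.1 e.2.2.1 inner).Pairwise fun r s =>
      r.2.1 ≤ s.1 ∨ s.2.1 ≤ r.1 ∨ r.2.2.2 ≤ s.2.2.1 ∨ s.2.2.2 ≤ r.2.2.1 := by
  have h := certRects_pairwise_disjoint
  rw [List.all_eq_true] at h
  have h1 := h e he
  rw [List.all_eq_true] at h1
  have h2 := h1 inner (by cases inner <;> simp)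
  exact of_decide_eq_true h2

end Summit.Parity.GeneralizedHardyLittlewood.FordMaynardSieveConst01651SieveConst01651
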